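import Literature.IUT.HodgeArakelov.RadialGraphs

/-!
# [IUTchII] §1, Example 1.9 (iii): the uniradial environment `Π ↦ Π/Δ` — PROOF companion

Proof-only companion (abc-iut cell, block C / W6 cone provers, seat abc-iut-w6-d020; W6-TRANCHE-1 row d020;
node **IUTchII:Ex1.9(iii)**, kernel id `N_IUTchII_Ex1_9_iii`) to the landed `RadialGraphs.lean`
(abc-iut-L6-t1, p406616; frozen, not edited). No definitions, no new `Prop` facts.

S. Mochizuki, *Inter-universal Teichmüller theory II*, kurims manuscript (Dec. 2020), Example 1.9 (iii),
p. 42 l. 49 – p. 43 l. 13 (verbatim): "(iii) On the other hand, one may also construct a radial environment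
as follows. We define a collection of radial data to be a topological group `Π` isomorphic to `Π^tp_{X̲̲_k}`,
and an isomorphism of collections of radial data to be an isomorphism of topological groups. The
definitions of coric data and isomorphisms of collections of coric data are the same as in Example 1.8, (i).
The radial functor `Φ : ℛ → 𝒞` is defined via the assignment `Π ↦ Π/Δ` [cf. the notation of Example 1.8,
(i)]. Thus, `Φ` fails to be full [cf., e.g., [AbsTopIII], §I3; [AbsTopIII], Remark 1.9.1]. That is to say,
`(ℛ, 𝒞, Φ)` is a uniradial environment. Now suppose that `Ξ : ℰ → ℱ` is as in (ii). Then since `ℛ` may be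
identified with `ℰ`, the graph of `Ξ : ℛ = ℰ → ℱ` yields a category `ℛ†` equipped with natural functors
`Ψ_ℛ : ℛ → ℛ†`, `Φ† : ℛ† → ℛ → 𝒞† := 𝒞`. … Since `(ℛ, 𝒞, Φ)` is a uniradial environment, it thus follows
that `Ψ_ℛ` is uniradially defined [cf. Example 1.7, (iv)]." Claim key `Mochizuki2012`, status DISPUTED
(D-0012); record-only.

WHAT THE LANDED FILE HAS. `ex19iii S Q` is the environment `(IsoClass Π^tp_{X̲̲_k}, IsoClass G_k, Q)` over
the quotient functor `Q` ("`Π ↦ Π/Δ`", an interface input); the sentence "`Φ` fails to be full" is the NAMED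
INPUT `quotientFunctor_not_full S Q := ¬ Q.Full` (plan/FACT-LIST F-0421, predicate class — consumed BY NAME,
never asserted); the conclusion "`Ψ_ℛ` is uniradially defined" is PROVED from it
(`ex19iii_uniradiallyDefined`).

WHAT IS PROVED HERE (kernel re-verification of the remaining printed sentences, and the group-theoretic
form of the named input):
* `ex19iii_R` / `ex19iii_C` / `ex19iii_Φ` — "since `ℛ` may be identified with `ℰ`": in the typed
  environment `ℛ` IS `ℰ = IsoClass Π^tp_{X̲̲_k}`, `𝒞 = IsoClass G_k`, `Φ = Q` (definitionally);
* `ex19iii_isUniradial_iff` / `ex19iii_isUniradial` — "That is to say, `(ℛ, 𝒞, Φ)` is a uniradial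
  environment" holds IF AND ONLY IF the named input holds: F-0421 is exactly necessary and sufficient for
  the node (nothing weaker closes it, nothing stronger is used); likewise `ex19iii_uniradiallyDefined_iff`
  for the conclusion about `Ψ_ℛ`, for every algorithm `Ξ`;
* `connectedGroupoid_full_iff_map_end_surjective` [folklore] — a functor out of a CONNECTED groupoid is full
  iff it is surjective on ONE vertex group `Aut(X) → End(Q X)`; hence
* `quotientFunctor_not_full_iff_not_surjective` / `quotientFunctor_not_full_iff_exists_aut` /
  `quotientFunctor_not_full_of_aut` — the named input in the GROUP-THEORETIC form in which the cited
  [AbsTopIII] passages assert it: "`Φ` fails to be full" ⟺ at one (any) isomorph `Π` of `Π^tp_{X̲̲_k}`, NOT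
  every automorphism of the topological group `Q(Π) ≅ G_k` is of the form `Q(f)` for an automorphism `f`
  of `Π` ⟺ some automorphism `σ` of some `Q(Π)` is induced by no automorphism of `Π`. [AbsTopIII] Remark
  1.9.4 (kurims p. 38 l. 38 – p. 39 l. 13, cited via §I3 p. 9: "the dimension corresponding to the inertia
  subgroup `I_k ⊆ G_k` … is not rigid [cf. Remark 1.9.4]"): "the dimension of `G_k` represented by the
  inertia group `I_k ⊆ G_k` … is “far from rigid” — a phenomenon that may be seen, for instance, in the
  existence [cf., e.g., [NSW], the Closing Remark preceding Theorem 12.2.7] of isomorphisms of absolute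
  Galois groups of MLF’s which fail … to be “RF-preserving”, “uniformly toral”, or “geometric”. By
  contrast, … the condition of being “coupled with `Δ_X`” [i.e., via the extension determined by `Π_X`]
  has the effect of rigidifying both of the 2 dimensions of `G_k` [cf. also Corollary 1.10 below]", and
  Remark 1.9.1 (p. 38 l. 25): "one may give a tempered version of Theorem 1.9 … in which the profinite
  étale fundamental group `Π_X` is replaced by the tempered fundamental group". The witness `σ` (a
  non-geometric automorphism of `G_k`) and the rigidification (every `Q(f)` is geometric) are [NSW] /
  [AbsTopIII] Thm 1.9, Cor 1.10 inputs of layer L4 — NOT proved here and not restated as `Prop`s: they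
  enter only through the binder `(hσ : ∀ f, Q.map f ≠ σ)` of `quotientFunctor_not_full_of_aut`;
* `ex19iii_uniradiallyDefined_of_aut` — the node's conclusion from such a witness;
* `IsoClass.subsingleton_end_of_subsingleton` / `not_quotientFunctor_not_full_of_subsingleton` —
  CONSISTENCY: the named input carries genuine content and is NOT derivable from the `ThetaSetting`
  interface alone: if `G_k` were the trivial topological group, every `Q` would be full. (So the node is
  discharged MODULO F-0421, honestly; F-0421 is a statement about the unmodelled pair `Π^tp_{X̲̲_k} ↠ G_k`.)

HONEST FRAMING: category theory over the typed interfaces; nothing here bears on [IUTchIII] Cor 3.12 or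
asserts anything about abc; typed ≠ endorsed. no side taken.
-/

namespace Literature.IUT.HodgeArakelov

open CategoryTheory

universe v v' u u'

/-! ## Fullness of a functor out of a connected groupoid is decided on one vertex group -/

section ConnectedGroupoid

variable {E : Type u} [Groupoid.{v} E] {D : Type u'} [Category.{v'} D] (Q : E ⥤ D)

/-- [folklore] A functor `Q` out of a groupoid `E` in which any two objects are connected by a morphism is
full as soon as it is surjective on ONE vertex group `Aut(X) = End(X) → End(Q X)`: conjugate a target
morphism `Q A → Q B` into `End(Q X)` along chosen `X → A`, `X → B`, lift, and conjugate back. (Folklore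
category theory; recorded as the form in which Example 1.9 (iii)'s "`Φ` fails to be full" — fullness being
multiradiality, Example 1.7 (ii) — is asserted and used.)
[claim: Mochizuki2012, status: disputed] (IUTchII §1 Ex 1.9 (iii), kurims p.43) -/
theorem connectedGroupoid_full_of_map_end_surjective (hE : ∀ X Y : E, Nonempty (X ⟶ Y)) (X : E)
    (h : Function.Surjective fun f : X ⟶ X => Q.map f) : Q.Full where
  map_surjective {A B} := by
    intro g
    obtain ⟨a⟩ := hE X A
    obtain ⟨b⟩ := hE X B
    obtain ⟨f, hf⟩ := h (Q.map a ≫ g ≫ Q.map (Groupoid.inv b))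
    refine ⟨Groupoid.inv a ≫ f ≫ b, ?_⟩
    have hf' : Q.map f = Q.map a ≫ g ≫ Q.map (Groupoid.inv b) := hf
    simp only [Functor.map_comp, hf', Category.assoc, Groupoid.inv_eq_inv, Functor.map_inv,
      IsIso.inv_hom_id_assoc, IsIso.inv_hom_id, Category.comp_id]

/-- [folklore] A full functor is surjective on every vertex group (folklore; plumbing for Example 1.9 (iii)).
[claim: Mochizuki2012, status: disputed] (IUTchII §1 Ex 1.9 (iii), kurims p.43) -/
theorem map_end_surjective_of_full [Q.Full] (X : E) :
    Function.Surjective fun f : X ⟶ X => Q.map f :=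
  fun g => Q.map_surjective g

/-- [folklore] For a functor out of a connected groupoid: full ⟺ surjective on the vertex group at any one
object `X` (folklore; the form in which Example 1.9 (iii)'s non-fullness is asserted).
[claim: Mochizuki2012, status: disputed] (IUTchII §1 Ex 1.9 (iii), kurims p.43) -/
theorem connectedGroupoid_full_iff_map_end_surjective (hE : ∀ X Y : E, Nonempty (X ⟶ Y)) (X : E) :
    Q.Full ↔ Function.Surjective fun f : X ⟶ X => Q.map f :=
  ⟨fun _ => map_end_surjective_of_full Q X, connectedGroupoid_full_of_map_end_surjective Q hE X⟩

/-- [folklore] For a functor out of a nonempty connected groupoid: NOT full ⟺ some endomorphism `σ` of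
some `Q X` is of the form `Q f` for no `f : X ⟶ X` (folklore; witness form of Example 1.9 (iii)'s
non-fullness). [claim: Mochizuki2012, status: disputed] (IUTchII §1 Ex 1.9 (iii), kurims p.43) -/
theorem connectedGroupoid_not_full_iff_exists_end (hE : ∀ X Y : E, Nonempty (X ⟶ Y)) [Nonempty E] :
    ¬ Q.Full ↔ ∃ (X : E) (σ : Q.obj X ⟶ Q.obj X), ∀ f : X ⟶ X, Q.map f ≠ σ := by
  constructor
  · intro hQ
    obtain ⟨X⟩ := ‹Nonempty E›
    by_contra hne
    refine hQ (connectedGroupoid_full_of_map_end_surjective Q hE X fun σ => ?_)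
    by_contra hσ
    exact hne ⟨X, σ, fun f hf => hσ ⟨f, hf⟩⟩
  · rintro ⟨X, σ, hσ⟩ hfull
    obtain ⟨f, hf⟩ := map_end_surjective_of_full Q X σ
    exact hσ f hf

end ConnectedGroupoid

/-! ## Example 1.9 (iii): the typed environment, its uniradiality, and the named input -/

section Ex19iii

variable (S : ThetaSetting.{u}) (Q : IsoClass S.PiX ⥤ IsoClass S.Gk)

/-- **IUTchII:Ex1.9(iii)** (kurims p. 43 l. 3): "since `ℛ` may be identified with `ℰ`" — in the typed
environment the category of radial data IS `ℰ = IsoClass Π^tp_{X̲̲_k}` (definitionally).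
[claim: Mochizuki2012, status: disputed] (IUTchII §1 Ex 1.9 (iii), kurims p.43) -/
theorem ex19iii_R [Q.EssSurj] :
    (Literature.IUT.HodgeArakelov.ex19iii S Q).R = IsoClass S.PiX := rfl

/-- **IUTchII:Ex1.9(iii)** (kurims p. 42 l. 53): "The definitions of coric data and isomorphisms of
collections of coric data are the same as in Example 1.8, (i)" — `𝒞 = IsoClass G_k` (definitionally).
[claim: Mochizuki2012, status: disputed] (IUTchII §1 Ex 1.9 (iii), kurims p.42) -/
theorem ex19iii_C [Q.EssSurj] :
    (Literature.IUT.HodgeArakelov.ex19iii S Q).C = IsoClass S.Gk := rfl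

/-- **IUTchII:Ex1.9(iii)** (kurims p. 42 l. 55): "The radial functor `Φ : ℛ → 𝒞` is defined via the
assignment `Π ↦ Π/Δ`" — `Φ` IS the quotient functor `Q` (definitionally).
[claim: Mochizuki2012, status: disputed] (IUTchII §1 Ex 1.9 (iii), kurims p.42) -/
theorem ex19iii_Φ [Q.EssSurj] :
    (Literature.IUT.HodgeArakelov.ex19iii S Q).Φ = Q := rfl

/-- **IUTchII:Ex1.9(iii)** (kurims p. 43 l. 1–2): "That is to say, `(ℛ, 𝒞, Φ)` is a uniradial
environment" — holds IF AND ONLY IF the named input "`Φ` fails to be full" (`quotientFunctor_not_full`,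
FACT-LIST F-0421) holds: the input is exactly necessary and sufficient.
[claim: Mochizuki2012, status: disputed] (IUTchII §1 Ex 1.9 (iii), kurims p.43) -/
theorem ex19iii_isUniradial_iff [Q.EssSurj] :
    (Literature.IUT.HodgeArakelov.ex19iii S Q).IsUniradial ↔
      Literature.IUT.HodgeArakelov.quotientFunctor_not_full S Q :=
  Iff.rfl

/-- **IUTchII:Ex1.9(iii)** (kurims p. 43 l. 1–2), PROVED from the named input: "`(ℛ, 𝒞, Φ)` is a
uniradial environment." [claim: Mochizuki2012, status: disputed] (IUTchII §1 Ex 1.9 (iii), kurims p.43) -/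
theorem ex19iii_isUniradial [Q.EssSurj]
    (hQ : Literature.IUT.HodgeArakelov.quotientFunctor_not_full S Q) :
    (Literature.IUT.HodgeArakelov.ex19iii S Q).IsUniradial :=
  hQ

/-- **IUTchII:Ex1.9(iii)** vs **(ii)** ("On the other hand", kurims p. 42 l. 49), PROVED from the named
input: the environment of (iii) is NOT multiradial (contrast: `ex18i_isMultiradial`,
`ex19ii_multiradiallyDefined` for the environment of Example 1.8 (i) used in (ii)).
[claim: Mochizuki2012, status: disputed] (IUTchII §1 Ex 1.9 (iii), kurims pp.42-43) -/
theorem ex19iii_not_isMultiradial [Q.EssSurj]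
    (hQ : Literature.IUT.HodgeArakelov.quotientFunctor_not_full S Q) :
    ¬ (Literature.IUT.HodgeArakelov.ex19iii S Q).IsMultiradial :=
  hQ

/-- **IUTchII:Ex1.9(iii)** (kurims p. 43 l. 7–8): "`Ψ_ℛ` is uniradially defined" holds, for every
functorial algorithm `Ξ`, IF AND ONLY IF the named input holds (the landed `ex19iii_uniradiallyDefined` is
the direction ⇐). [claim: Mochizuki2012, status: disputed] (IUTchII §1 Ex 1.9 (iii), kurims p.43) -/
theorem ex19iii_uniradiallyDefined_iff [Q.EssSurj] {F : Type u'} [Category.{v'} F]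
    (Ξ : IsoClass S.PiX ⥤ F) :
    ((Literature.IUT.HodgeArakelov.ex19iii S Q).toDagger Ξ).IsUniradiallyDefined ↔
      Literature.IUT.HodgeArakelov.quotientFunctor_not_full S Q :=
  Iff.rfl

/-- **IUTchII:Ex1.9(iii)**, the named input "`Φ` fails to be full [cf., e.g., [AbsTopIII], §I3; [AbsTopIII],
Remark 1.9.1]" (kurims p. 42 l. 57 – p. 43 l. 1) in GROUP-THEORETIC form at any one isomorph `Π` of
`Π^tp_{X̲̲_k}`: it holds iff NOT every automorphism of the topological group `Q(Π)` (`≅ Π/Δ ≅ G_k`) is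
`Q(f)` for an automorphism `f` of `Π` — [AbsTopIII] Rmk 1.9.4 (kurims pp. 38–39): the inertia dimension of
`G_k` "is “far from rigid”" ([NSW], Closing Remark preceding Thm 12.2.7) while "being “coupled with `Δ_X`”
… has the effect of rigidifying both of the 2 dimensions of `G_k`" (Thm 1.9 / Cor 1.10; tempered version
Rmk 1.9.1). PROVED (pure category theory: `IsoClass Π^tp` is a connected groupoid).
[claim: Mochizuki2012, status: disputed] (IUTchII §1 Ex 1.9 (iii), kurims pp.42-43) -/
theorem quotientFunctor_not_full_iff_not_surjective (P : IsoClass S.PiX) :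
    Literature.IUT.HodgeArakelov.quotientFunctor_not_full S Q ↔
      ¬ Function.Surjective fun f : P ⟶ P => Q.map f :=
  not_congr (connectedGroupoid_full_iff_map_end_surjective Q IsoClass.nonempty_hom P)

/-- **IUTchII:Ex1.9(iii)**, the named input in WITNESS form: "`Φ` fails to be full" iff some automorphism
`σ` of some `Q(Π)` (`Π ≅ Π^tp_{X̲̲_k}`) is induced by NO automorphism of `Π` — the shape of the cited
[AbsTopIII] §I3 / Rmk 1.9.4 phenomenon (a non-"geometric" automorphism of `G_k`). PROVED (category theory).
[claim: Mochizuki2012, status: disputed] (IUTchII §1 Ex 1.9 (iii), kurims pp.42-43) -/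
theorem quotientFunctor_not_full_iff_exists_aut :
    Literature.IUT.HodgeArakelov.quotientFunctor_not_full S Q ↔
      ∃ (P : IsoClass S.PiX) (σ : Q.obj P ⟶ Q.obj P), ∀ f : P ⟶ P, Q.map f ≠ σ :=
  haveI : Nonempty (IsoClass S.PiX) := ⟨IsoClass.base S.PiX⟩
  connectedGroupoid_not_full_iff_exists_end Q IsoClass.nonempty_hom

/-- **IUTchII:Ex1.9(iii)**, the named input FROM a witness: one automorphism `σ` of one `Q(Π)` not of the
form `Q(f)` gives "`Φ` fails to be full". (The witness — a non-geometric automorphism of `G_k`, [NSW] via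
[AbsTopIII] Rmk 1.9.4 — and the rigidification making every `Q(f)` geometric — [AbsTopIII] Thm 1.9 / Cor 1.10,
Rmk 1.9.1 — are layer-L4 inputs entering only through the binder `hσ`; they are not restated here.)
[claim: Mochizuki2012, status: disputed] (IUTchII §1 Ex 1.9 (iii), kurims pp.42-43) -/
theorem quotientFunctor_not_full_of_aut (P : IsoClass S.PiX) (σ : Q.obj P ⟶ Q.obj P)
    (hσ : ∀ f : P ⟶ P, Q.map f ≠ σ) :
    Literature.IUT.HodgeArakelov.quotientFunctor_not_full S Q :=
  (quotientFunctor_not_full_iff_exists_aut S Q).2 ⟨P, σ, hσ⟩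

/-- **IUTchII:Ex1.9(iii)** (kurims p. 43 l. 7–13), the node's conclusion from a group-theoretic witness:
given an automorphism of some `Q(Π)` induced by no automorphism of `Π`, "any “functorial group-theoretic
algorithm” whose input data consists of a topological group isomorphic to `Π^tp_{X̲̲_k}` also gives rise —
in a tautological fashion — to a uniradially defined functor."
[claim: Mochizuki2012, status: disputed] (IUTchII §1 Ex 1.9 (iii), kurims p.43) -/
theorem ex19iii_uniradiallyDefined_of_aut [Q.EssSurj] (P : IsoClass S.PiX) (σ : Q.obj P ⟶ Q.obj P)
    (hσ : ∀ f : P ⟶ P, Q.map f ≠ σ) {F : Type u'} [Category.{v'} F] (Ξ : IsoClass S.PiX ⥤ F) :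
    ((Literature.IUT.HodgeArakelov.ex19iii S Q).toDagger Ξ).IsUniradiallyDefined :=
  Literature.IUT.HodgeArakelov.ex19iii_uniradiallyDefined S Q
    (quotientFunctor_not_full_of_aut S Q P σ hσ) Ξ

/-! ## Consistency: the named input is not derivable from the interface alone -/

/-- CONSISTENCY (folklore): if the coric group `G_k` of the interface were the trivial topological group,
every isomorph of it would have exactly one automorphism (as a topological group) — plumbing for the
consistency statement on Example 1.9 (iii)'s named input below.
[claim: Mochizuki2012, status: disputed] (IUTchII §1 Ex 1.9 (iii), kurims p.43) -/
theorem IsoClass.subsingleton_end_of_subsingleton [Subsingleton S.Gk] (G : IsoClass S.Gk) :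
    Subsingleton (G ⟶ G) := by
  obtain ⟨e⟩ := G.iso
  haveI : Subsingleton G.G := e.toEquiv.injective.subsingleton
  exact ⟨fun f g => ContinuousMulEquiv.ext fun x => Subsingleton.elim _ _⟩

/-- CONSISTENCY: the named input `quotientFunctor_not_full` (F-0421) carries genuine content about the
unmodelled pair `Π^tp_{X̲̲_k} ↠ G_k` and cannot be discharged from the `ThetaSetting` interface alone — with
a trivial `G_k` EVERY functor `Q : IsoClass Π^tp ⥤ IsoClass G_k` is full, so "`Φ` fails to be full" fails.
(Node IUTchII:Ex1.9(iii) is therefore discharged MODULO F-0421, whose content is the cited [AbsTopIII] §I3 /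
Rmk 1.9.4 / Rmk 1.9.1 material of layer L4.) Consistency statement about the cited sentence "`Φ` fails to
be full"; proves nothing of Mochizuki's. [claim: Mochizuki2012, status: disputed] (IUTchII §1 Ex 1.9 (iii), kurims p.43) -/
theorem not_quotientFunctor_not_full_of_subsingleton [Subsingleton S.Gk] :
    ¬ Literature.IUT.HodgeArakelov.quotientFunctor_not_full S Q := by
  rw [quotientFunctor_not_full_iff_not_surjective S Q (IsoClass.base S.PiX), not_not]
  intro σ
  haveI := IsoClass.subsingleton_end_of_subsingleton S (Q.obj (IsoClass.base S.PiX))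
  exact ⟨𝟙 _, Subsingleton.elim _ _⟩

end Ex19iii

end Literature.IUT.HodgeArakelov
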